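import Literature.MathematicalPhysics.QuantumFieldTheory.StrongCouplingPolymerSystem

/-!
# Truncated correlations of a plaquette system vanish to the order of the joining number

Support file for `StrongCouplingShape` (route `ConvexGribovBody`, item stmt-QuantumFields-8783):
the Osterwalder–Seiler mechanism "only clusters connecting the two supports contribute to a
truncated expectation", in the abstract setting of a plaquette system
`S : PlaqSystem d G ι` of `StrongCouplingPolymerSystem` and for complex coupling `β` near `0`.

For observables `F₁`, `F₂` supported on bond sets `B₁`, `B₂` and a finite label set `V`, a
subset `R ⊆ V` *joins* `B₁` to `B₂` when `B₁` meets `B₂` or some label of the part of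
`R` reachable from `B₁` through shared bonds (`joined`) touches `B₂`. If every joining `R ⊆ V`
has at least `k` labels, then the truncated expectation
`⟨F₁ F₂⟩_V(β) - ⟨F₁⟩_V(β) ⟨F₂⟩_V(β)` is `O(β^k)` at `β = 0` (`truncated_isBigO`).

Proof: expand `numZ (F₁F₂) · partZ - numZ F₁ · numZ F₂` with `numZ = ∑_Q aPol` into a sum over
pairs `(Q, Q')`; by independence of bond-disjoint blocks of the Haar product the term of a pair
whose union does not join factorises through the joined part, and the pairs cancel two by two
under the exchange of their non-joined parts (`Finset.sum_involution`); every surviving pair has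
`|Q| + |Q'| ≥ k` and `aPol F Q = O(β^{|Q|})`.
-/

noncomputable section

open MeasureTheory Filter Topology Finset Asymptotics
open Literature.MathematicalPhysics.QuantumFieldTheory

namespace Summit.QuantumFields.YangMills.Theorems.StrongCouplingShape

variable {d : ℕ} {G : Type*} {ι : Type*}

/-! ### Joined parts and joining sets

The part of a label set `R` *joined* to a bond set `B` through `R` — the labels of `R` reachable
inside `R`, through chains of labels sharing bonds, from a label touching `B` — is
`𝓙[S, B, R]` (`PolymerCombinatorics`); `R` *joins* `B₁` to `B₂` when
`B₁` meets `B₂` or a label of the part of `R` joined to `B₁` touches `B₂`. -/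

/-- `𝓙[S, B, R]`: the part of the label set `R` joined to the bond set `B` through `R`. -/
local notation "𝓙[" S ", " B ", " R "]" =>
  Polymer.seedReach (PlaqSystem.Adj S) (PlaqSystem.Touches S B) R

section Joined

variable {S : PlaqSystem d G ι}

/-- A label of `R` outside the joined part neither touches `B` nor shares a bond with the joined
part. [folklore] -/
theorem not_touches_and_not_adj_of_not_mem_joined [DecidableEq ι] {B : Finset (ZdEdge d)}
    {R : Finset ι} {p : ι} (hp : p ∈ R) (hpj : p ∉ 𝓙[S, B, R]) :
    ¬ S.Touches B p ∧ ∀ x ∈ 𝓙[S, B, R], ¬ S.Adj x p := by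
  have h := Polymer.sdiff_seedReach_subset (adj := S.Adj) (s := S.Touches B) (subset_refl R)
    (Finset.mem_sdiff.2 ⟨hp, hpj⟩)
  rw [Finset.mem_sdiff, Polymer.mem_snbhd] at h
  obtain ⟨-, h⟩ := h
  push Not at h
  exact h hp

/-- Outside the joined part, bonds avoid `B`. [folklore] -/
theorem disjoint_bonds_of_not_mem_joined [DecidableEq ι] {B : Finset (ZdEdge d)} {R : Finset ι}
    {p : ι} (hp : p ∈ R) (hpj : p ∉ 𝓙[S, B, R]) : Disjoint (S.bonds p) B :=
  not_not.1 (not_touches_and_not_adj_of_not_mem_joined hp hpj).1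

/-- If `R` does not join `B₁` to `B₂`, the bonds of its joined part avoid `B₂`. [folklore] -/
theorem disjoint_bonds_of_mem_joined_of_not_joins {B₁ B₂ : Finset (ZdEdge d)} {R : Finset ι}
    (hJ : ¬ (¬ Disjoint B₁ B₂ ∨ ∃ p ∈ 𝓙[S, B₁, R], S.Touches B₂ p)) {p : ι}
    (hp : p ∈ 𝓙[S, B₁, R]) : Disjoint (S.bonds p) B₂ := by
  by_contra h
  exact hJ (Or.inr ⟨p, hp, h⟩)

/-- If `R` does not join `B₁` to `B₂`, the two bond sets are disjoint. [folklore] -/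
theorem disjoint_of_not_joins {B₁ B₂ : Finset (ZdEdge d)} {R : Finset ι}
    (hJ : ¬ (¬ Disjoint B₁ B₂ ∨ ∃ p ∈ 𝓙[S, B₁, R], S.Touches B₂ p)) : Disjoint B₁ B₂ := by
  by_contra h
  exact hJ (Or.inl h)

end Joined

/-! ### Factorisation of decorated activities over independent blocks -/

section Factor

variable [Group G] [TopologicalSpace G] [IsTopologicalGroup G] [CompactSpace G] [MeasurableSpace G]
  [BorelSpace G] [DecidableEq ι] {S : PlaqSystem d G ι} {M : ℝ} {D : ℕ}

/-- **Factorisation over bond-disjoint blocks.** If `F₁` lives on `B₁`, `F₂` on `B₂`, the label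
sets `Q₁`, `Q₂` share no bond, the bonds of `Q₂` avoid `B₁`, those of `Q₁` avoid `B₂` and
`B₁ ∩ B₂ = ∅`, then `a_{F₁F₂}(Q₁ ∪ Q₂) = a_{F₁}(Q₁) a_{F₂}(Q₂)` (independence of disjoint blocks
of the Haar product). [folklore] -/
theorem aPol_mul_union (hR : S.Regular M D) {B₁ B₂ : Finset (ZdEdge d)}
    {F₁ F₂ : ZdGaugeConfig d G → ℂ} (h₁m : Measurable F₁) (h₂m : Measurable F₂)
    (h₁B : DependsOn F₁ (B₁ : Set (ZdEdge d))) (h₂B : DependsOn F₂ (B₂ : Set (ZdEdge d)))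
    {Q₁ Q₂ : Finset ι} (hB : Disjoint B₁ B₂) (h₂₁ : ∀ p ∈ Q₂, Disjoint (S.bonds p) B₁)
    (h₁₂ : ∀ p ∈ Q₁, Disjoint (S.bonds p) B₂) (hadj : ∀ p ∈ Q₂, ∀ x ∈ Q₁, ¬ S.Adj x p) (β : ℂ) :
    S.aPol (fun U => F₁ U * F₂ U) (Q₁ ∪ Q₂) β = S.aPol F₁ Q₁ β * S.aPol F₂ Q₂ β := by
  have hdisj : Disjoint Q₁ Q₂ := by
    rw [Finset.disjoint_left]
    intro p hp₁ hp₂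
    exact hadj p hp₂ p hp₁ (Std.Refl.refl p)
  have hbond : Disjoint (B₁ ∪ Q₁.biUnion S.bonds) (B₂ ∪ Q₂.biUnion S.bonds) := by
    rw [Finset.disjoint_union_left, Finset.disjoint_union_right, Finset.disjoint_union_right,
      Finset.disjoint_biUnion_right, Finset.disjoint_biUnion_left, Finset.disjoint_biUnion_left]
    refine ⟨⟨hB, fun p hp => (h₂₁ p hp).symm⟩, fun p hp => h₁₂ p hp, fun p hp => ?_⟩
    rw [Finset.disjoint_biUnion_right]
    intro q hq
    exact not_not.1 (hadj q hq p hp)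
  have hdep₁ : DependsOn (fun U => F₁ U * S.weightProd β Q₁ U)
      ((B₁ ∪ Q₁.biUnion S.bonds : Finset (ZdEdge d)) : Set (ZdEdge d)) := by
    intro U V h
    have e1 : F₁ U = F₁ V :=
      h₁B fun i hi => h i (by simp only [Finset.coe_union, Set.mem_union]; exact Or.inl hi)
    have e2 : S.weightProd β Q₁ U = S.weightProd β Q₁ V :=
      S.dependsOn_weightProd β Q₁ fun i hi => h i (by
        simp only [Finset.coe_union, Set.mem_union]; exact Or.inr hi)
    show F₁ U * S.weightProd β Q₁ U = F₁ V * S.weightProd β Q₁ V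
    rw [e1, e2]
  have hdep₂ : DependsOn (fun U => F₂ U * S.weightProd β Q₂ U)
      ((B₂ ∪ Q₂.biUnion S.bonds : Finset (ZdEdge d)) : Set (ZdEdge d)) := by
    intro U V h
    have e1 : F₂ U = F₂ V :=
      h₂B fun i hi => h i (by simp only [Finset.coe_union, Set.mem_union]; exact Or.inl hi)
    have e2 : S.weightProd β Q₂ U = S.weightProd β Q₂ V :=
      S.dependsOn_weightProd β Q₂ fun i hi => h i (by
        simp only [Finset.coe_union, Set.mem_union]; exact Or.inr hi)
    show F₂ U * S.weightProd β Q₂ U = F₂ V * S.weightProd β Q₂ V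
    rw [e1, e2]
  unfold PlaqSystem.aPol
  calc ∫ U, F₁ U * F₂ U * S.weightProd β (Q₁ ∪ Q₂) U ∂(zdHaar d G)
      = ∫ U, (F₁ U * S.weightProd β Q₁ U) * (F₂ U * S.weightProd β Q₂ U) ∂(zdHaar d G) := by
        refine integral_congr_ae (Eventually.of_forall fun U => ?_)
        show F₁ U * F₂ U * S.weightProd β (Q₁ ∪ Q₂) U =
          (F₁ U * S.weightProd β Q₁ U) * (F₂ U * S.weightProd β Q₂ U)
        simp only [PlaqSystem.weightProd, Finset.prod_union hdisj]
        ring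
    _ = (∫ U, F₁ U * S.weightProd β Q₁ U ∂(zdHaar d G)) *
          ∫ U, F₂ U * S.weightProd β Q₂ U ∂(zdHaar d G) :=
        integral_mul_of_dependsOn hbond (h₁m.mul (PlaqSystem.measurable_weightProd hR β Q₁))
          (h₂m.mul (PlaqSystem.measurable_weightProd hR β Q₂)) hdep₁ hdep₂

end Factor

/-! ### The cancellation of non-joining pairs and the order of the truncated expectation -/

section Truncated

variable [Group G] [TopologicalSpace G] [IsTopologicalGroup G] [CompactSpace G] [MeasurableSpace G]
  [BorelSpace G] [DecidableEq ι] {S : PlaqSystem d G ι} {M : ℝ} {D : ℕ}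

omit [DecidableEq ι] in
/-- The partition function at `β = 0` is `1`. [folklore] -/
theorem partZ_zero (V : Finset ι) : S.partZ V 0 = 1 := by
  simp [PlaqSystem.partZ_eq, PlaqSystem.weight]

omit [DecidableEq ι] in
/-- The inverse square of the partition function is bounded near `β = 0`. [folklore] -/
theorem isBigO_inv_partZ_sq (hR : S.Regular M D) (V : Finset ι) :
    (fun β => ((S.partZ V β) ^ 2)⁻¹) =O[𝓝 (0 : ℂ)] fun _ => (1 : ℂ) := by
  have hc : ContinuousAt (S.partZ V) 0 :=
    (PlaqSystem.differentiable_partZ hR V).continuous.continuousAt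
  have hev : ∀ᶠ β in 𝓝 (0 : ℂ), ‖S.partZ V β - 1‖ < 1 / 2 := by
    have h := Metric.tendsto_nhds.1 hc (1 / 2) (by norm_num)
    refine h.mono fun β hβ => ?_
    rwa [dist_eq_norm, partZ_zero] at hβ
  refine IsBigO.of_bound 4 (hev.mono fun β hβ => ?_)
  have h1 : (1 : ℝ) / 2 ≤ ‖S.partZ V β‖ := by
    have := norm_sub_norm_le (1 : ℂ) (S.partZ V β)
    rw [norm_one, norm_sub_rev] at this
    linarith
  have hpos : 0 < ‖S.partZ V β‖ := lt_of_lt_of_le (by norm_num) h1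
  rw [norm_inv, norm_pow, norm_one, mul_one, inv_le_comm₀ (pow_pos hpos 2) (by norm_num)]
  nlinarith

/-- **Truncated expectations vanish to the order of the joining number.** If every `R ⊆ V`
joining the supports `B₁`, `B₂` of `F₁`, `F₂` has at least `k` labels, then
`⟨F₁F₂⟩_V - ⟨F₁⟩_V ⟨F₂⟩_V = O(β^k)` at `β = 0` (Osterwalder–Seiler's "only connecting clusters
contribute", via the cancellation of non-joining pairs of the double expansion). [folklore] -/
theorem truncated_isBigO (hR : S.Regular M D) {B₁ B₂ : Finset (ZdEdge d)}
    {F₁ F₂ : ZdGaugeConfig d G → ℂ} (h₁m : Measurable F₁) (h₂m : Measurable F₂) {C₁ C₂ : ℝ}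
    (h₁b : ∀ U, ‖F₁ U‖ ≤ C₁) (h₂b : ∀ U, ‖F₂ U‖ ≤ C₂)
    (h₁B : DependsOn F₁ (B₁ : Set (ZdEdge d))) (h₂B : DependsOn F₂ (B₂ : Set (ZdEdge d)))
    (V : Finset ι) {k : ℕ}
    (hk : ∀ R ⊆ V, (¬ Disjoint B₁ B₂ ∨ ∃ p ∈ 𝓙[S, B₁, R], S.Touches B₂ p) → k ≤ R.card) :
    (fun β => S.expect (fun U => F₁ U * F₂ U) V β - S.expect F₁ V β * S.expect F₂ V β)
      =O[𝓝 (0 : ℂ)] fun β => β ^ k := by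
  -- the terms of the double expansion
  set g : Finset ι × Finset ι → ℂ → ℂ := fun x β =>
    S.aPol (fun U => F₁ U * F₂ U) x.1 β * S.zPol x.2 β - S.aPol F₁ x.1 β * S.aPol F₂ x.2 β with hg
  set P := V.powerset ×ˢ V.powerset with hP
  have h₁₂m : Measurable fun U => F₁ U * F₂ U := h₁m.mul h₂m
  have hC₁ : 0 ≤ C₁ := (norm_nonneg _).trans (h₁b fun _ => 1)
  have h₁₂b : ∀ U, ‖F₁ U * F₂ U‖ ≤ C₁ * C₂ := fun U => by
    rw [norm_mul]; exact mul_le_mul (h₁b U) (h₂b U) (norm_nonneg _) hC₁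
  -- the double expansion
  have hexp : ∀ β, S.numZ (fun U => F₁ U * F₂ U) V β * S.partZ V β -
      S.numZ F₁ V β * S.numZ F₂ V β = ∑ x ∈ P, g x β := by
    intro β
    rw [PlaqSystem.numZ_eq_sum hR h₁₂m h₁₂b, PlaqSystem.partZ_eq_sum hR,
      PlaqSystem.numZ_eq_sum hR h₁m h₁b, PlaqSystem.numZ_eq_sum hR h₂m h₂b, Finset.sum_mul_sum,
      Finset.sum_mul_sum, hP, Finset.sum_product, ← Finset.sum_sub_distrib]
    refine Finset.sum_congr rfl fun Q _ => ?_
    rw [← Finset.sum_sub_distrib]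
  -- non-joining pairs cancel
  have hcancel : ∀ β, ∑ x ∈ P.filter (fun x : Finset ι × Finset ι =>
      ¬ (¬ Disjoint B₁ B₂ ∨ ∃ p ∈ 𝓙[S, B₁, x.1 ∪ x.2], S.Touches B₂ p)), g x β = 0 := by
    intro β
    -- the swap of the non-joined parts
    set J : Finset ι × Finset ι → Finset ι := fun x => 𝓙[S, B₁, x.1 ∪ x.2] with hJ
    set Φ : Finset ι × Finset ι → Finset ι × Finset ι := fun x =>
      (x.1 ∩ J x ∪ x.2 \ J x, x.2 ∩ J x ∪ x.1 \ J x) with hΦ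
    have hU : ∀ x, (Φ x).1 ∪ (Φ x).2 = x.1 ∪ x.2 := fun x => by
      simp only [hΦ]
      rw [Polymer.inter_union_sdiff_swap_union, Finset.union_comm]
    have hJΦ : ∀ x, J (Φ x) = J x := fun x => by simp only [hJ, hU]
    have hΦΦ : ∀ x, Φ (Φ x) = x := by
      intro x
      have h := hJΦ x
      ext p
      · simp only [hΦ] at h ⊢
        rw [h]
        simp only [Finset.mem_union, Finset.mem_inter, Finset.mem_sdiff]
        tauto
      · simp only [hΦ] at h ⊢
        rw [h]
        simp only [Finset.mem_union, Finset.mem_inter, Finset.mem_sdiff]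
        tauto
    -- the value of `g` on a pair split along the joined part of its union
    have key : ∀ (R : Finset ι), ¬ (¬ Disjoint B₁ B₂ ∨ ∃ p ∈ 𝓙[S, B₁, R], S.Touches B₂ p) →
        ∀ A₁ A₂ A₁' A₂' : Finset ι, A₁ ⊆ 𝓙[S, B₁, R] → A₁' ⊆ 𝓙[S, B₁, R] →
        A₂ ⊆ R \ 𝓙[S, B₁, R] → A₂' ⊆ R \ 𝓙[S, B₁, R] →
        g (A₁ ∪ A₂, A₁' ∪ A₂') β = S.aPol F₁ A₁ β * S.zPol A₁' β *
          (S.aPol F₂ A₂ β * S.zPol A₂' β - S.zPol A₂ β * S.aPol F₂ A₂' β) := by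
      intro R hRJ A₁ A₂ A₁' A₂' hA₁ hA₁' hA₂ hA₂'
      have out : ∀ {A : Finset ι}, A ⊆ R \ 𝓙[S, B₁, R] → ∀ p ∈ A,
          Disjoint (S.bonds p) B₁ ∧ ∀ x ∈ 𝓙[S, B₁, R], ¬ S.Adj x p := by
        intro A hA p hp
        have h := Finset.mem_sdiff.1 (hA hp)
        exact ⟨disjoint_bonds_of_not_mem_joined h.1 h.2,
          (not_touches_and_not_adj_of_not_mem_joined h.1 h.2).2⟩
      have hBB : Disjoint B₁ B₂ := disjoint_of_not_joins hRJ
      have inJ : ∀ {A : Finset ι}, A ⊆ 𝓙[S, B₁, R] → ∀ p ∈ A, Disjoint (S.bonds p) B₂ :=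
        fun hA p hp => disjoint_bonds_of_mem_joined_of_not_joins hRJ (hA hp)
      have hm1 : Measurable fun _ : ZdGaugeConfig d G => (1 : ℂ) := measurable_const
      have hd1 : DependsOn (fun _ : ZdGaugeConfig d G => (1 : ℂ)) ((∅ : Finset (ZdEdge d)) :
          Set (ZdEdge d)) := fun _ _ _ => rfl
      -- the four factorisations
      have e1 : S.aPol (fun U => F₁ U * F₂ U) (A₁ ∪ A₂) β = S.aPol F₁ A₁ β * S.aPol F₂ A₂ β :=
        aPol_mul_union hR h₁m h₂m h₁B h₂B hBB (fun p hp => (out hA₂ p hp).1) (inJ hA₁)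
          (fun p hp x hx => (out hA₂ p hp).2 x (hA₁ hx)) β
      have e2 : S.zPol (A₁' ∪ A₂') β = S.zPol A₁' β * S.zPol A₂' β := by
        have h := aPol_mul_union hR (F₁ := fun _ => (1 : ℂ)) (F₂ := fun _ => (1 : ℂ)) hm1 hm1
          hd1 hd1 (Q₁ := A₁') (Q₂ := A₂') (Finset.disjoint_empty_left _)
          (fun p _ => Finset.disjoint_empty_right _) (fun p _ => Finset.disjoint_empty_right _)
          (fun p hp x hx => (out hA₂' p hp).2 x (hA₁' hx)) β
        simpa [PlaqSystem.zPol] using h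
      have e3 : S.aPol F₁ (A₁ ∪ A₂) β = S.aPol F₁ A₁ β * S.zPol A₂ β := by
        have h := aPol_mul_union hR (F₂ := fun _ => (1 : ℂ)) h₁m hm1 h₁B hd1 (Q₁ := A₁)
          (Q₂ := A₂) (Finset.disjoint_empty_right _) (fun p hp => (out hA₂ p hp).1)
          (fun p _ => Finset.disjoint_empty_right _)
          (fun p hp x hx => (out hA₂ p hp).2 x (hA₁ hx)) β
        simpa [PlaqSystem.zPol] using h
      have e4 : S.aPol F₂ (A₁' ∪ A₂') β = S.zPol A₁' β * S.aPol F₂ A₂' β := by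
        have h := aPol_mul_union hR (F₁ := fun _ => (1 : ℂ)) hm1 h₂m hd1 h₂B (Q₁ := A₁')
          (Q₂ := A₂') (Finset.disjoint_empty_left _) (fun p _ => Finset.disjoint_empty_right _)
          (inJ hA₁')
          (fun p hp x hx => (out hA₂' p hp).2 x (hA₁' hx)) β
        simpa [PlaqSystem.zPol] using h
      simp only [hg]
      rw [e1, e2, e3, e4]
      ring
    refine Finset.sum_involution (fun x _ => Φ x) ?_ ?_ ?_ ?_
    · -- cancellation in pairs
      intro x hx
      obtain ⟨-, hxJ⟩ := Finset.mem_filter.1 hx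
      set R := x.1 ∪ x.2 with hRdef
      have hx1 : x = (x.1 ∩ J x ∪ x.1 \ J x, x.2 ∩ J x ∪ x.2 \ J x) := by
        ext p <;> simp only [Finset.mem_union, Finset.mem_inter, Finset.mem_sdiff] <;> tauto
      have s1 : x.1 ∩ J x ⊆ 𝓙[S, B₁, R] := Finset.inter_subset_right
      have s2 : x.2 ∩ J x ⊆ 𝓙[S, B₁, R] := Finset.inter_subset_right
      have s3 : x.1 \ J x ⊆ R \ 𝓙[S, B₁, R] :=
        Finset.sdiff_subset_sdiff Finset.subset_union_left subset_rfl
      have s4 : x.2 \ J x ⊆ R \ 𝓙[S, B₁, R] :=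
        Finset.sdiff_subset_sdiff Finset.subset_union_right subset_rfl
      have g1 := key R hxJ _ _ _ _ s1 s2 s3 s4
      have g2 := key R hxJ _ _ _ _ s1 s2 s4 s3
      rw [← hx1] at g1
      show g x β + g (Φ x) β = 0
      rw [g1, g2]
      ring
    · -- no fixed point carries a non-zero term
      intro x hx hne hfix
      have h := (show ∀ x ∈ P.filter (fun x : Finset ι × Finset ι =>
        ¬ (¬ Disjoint B₁ B₂ ∨ ∃ p ∈ 𝓙[S, B₁, x.1 ∪ x.2], S.Touches B₂ p)),
          g x β + g (Φ x) β = 0 from ?_) x hx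
      · rw [hfix, ← two_mul, mul_eq_zero] at h
        exact hne (h.resolve_left two_ne_zero)
      · intro x hx
        obtain ⟨-, hxJ⟩ := Finset.mem_filter.1 hx
        set R := x.1 ∪ x.2 with hRdef
        have hx1 : x = (x.1 ∩ J x ∪ x.1 \ J x, x.2 ∩ J x ∪ x.2 \ J x) := by
          ext p <;> simp only [Finset.mem_union, Finset.mem_inter, Finset.mem_sdiff] <;> tauto
        have s1 : x.1 ∩ J x ⊆ 𝓙[S, B₁, R] := Finset.inter_subset_right
        have s2 : x.2 ∩ J x ⊆ 𝓙[S, B₁, R] := Finset.inter_subset_right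
        have s3 : x.1 \ J x ⊆ R \ 𝓙[S, B₁, R] :=
          Finset.sdiff_subset_sdiff Finset.subset_union_left subset_rfl
        have s4 : x.2 \ J x ⊆ R \ 𝓙[S, B₁, R] :=
          Finset.sdiff_subset_sdiff Finset.subset_union_right subset_rfl
        have g1 := key R hxJ _ _ _ _ s1 s2 s3 s4
        have g2 := key R hxJ _ _ _ _ s1 s2 s4 s3
        rw [← hx1] at g1
        rw [g1, g2]
        ring
    · -- the swap preserves the set of non-joining pairs
      intro x hx
      obtain ⟨hxP, hxJ⟩ := Finset.mem_filter.1 hx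
      rw [hP, Finset.mem_product, Finset.mem_powerset, Finset.mem_powerset] at hxP
      refine Finset.mem_filter.2 ⟨?_, by rw [hU]; exact hxJ⟩
      rw [hP, Finset.mem_product, Finset.mem_powerset, Finset.mem_powerset]
      simp only [hΦ]
      refine ⟨Finset.union_subset (Finset.inter_subset_left.trans hxP.1)
        (Finset.sdiff_subset.trans hxP.2), Finset.union_subset
        (Finset.inter_subset_left.trans hxP.2) (Finset.sdiff_subset.trans hxP.1)⟩
    · intro x _
      exact hΦΦ x
  -- the surviving pairs are of order `k`
  have hbig : (fun β => ∑ x ∈ P, g x β) =O[𝓝 (0 : ℂ)] fun β => β ^ k := by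
    have hsplit : ∀ β, ∑ x ∈ P, g x β = ∑ x ∈ P.filter (fun x : Finset ι × Finset ι =>
        (¬ Disjoint B₁ B₂ ∨ ∃ p ∈ 𝓙[S, B₁, x.1 ∪ x.2], S.Touches B₂ p)), g x β := by
      intro β
      rw [← Finset.sum_filter_add_sum_filter_not P (fun x : Finset ι × Finset ι =>
        (¬ Disjoint B₁ B₂ ∨ ∃ p ∈ 𝓙[S, B₁, x.1 ∪ x.2], S.Touches B₂ p)), hcancel β, add_zero]
    simp only [hsplit]
    refine IsBigO.sum fun x hx => ?_
    obtain ⟨hxP, hxJ⟩ := Finset.mem_filter.1 hx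
    rw [hP, Finset.mem_product, Finset.mem_powerset, Finset.mem_powerset] at hxP
    have hkx : k ≤ x.1.card + x.2.card :=
      (hk _ (Finset.union_subset hxP.1 hxP.2) hxJ).trans (Finset.card_union_le _ _)
    have t1 : (fun β => S.aPol (fun U => F₁ U * F₂ U) x.1 β * S.zPol x.2 β) =O[𝓝 (0 : ℂ)]
        fun β => β ^ (x.1.card + x.2.card) :=
      ((PlaqSystem.aPol_isBigO hR h₁₂b x.1).mul (PlaqSystem.zPol_isBigO hR x.2)).congr_right
        fun _ => by rw [pow_add]
    have t2 : (fun β => S.aPol F₁ x.1 β * S.aPol F₂ x.2 β) =O[𝓝 (0 : ℂ)]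
        fun β => β ^ (x.1.card + x.2.card) :=
      ((PlaqSystem.aPol_isBigO hR h₁b x.1).mul (PlaqSystem.aPol_isBigO hR h₂b x.2)).congr_right
        fun _ => by rw [pow_add]
    exact (t1.sub t2).trans (isBigO_pow_pow_of_le hkx)
  -- division by the square of the partition function
  have hev : (fun β => S.expect (fun U => F₁ U * F₂ U) V β - S.expect F₁ V β * S.expect F₂ V β)
      =ᶠ[𝓝 (0 : ℂ)] fun β => (∑ x ∈ P, g x β) * ((S.partZ V β) ^ 2)⁻¹ := by
    filter_upwards [PlaqSystem.closedBall_betaR_mem_nhds hR] with β hβ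
    rw [Metric.mem_closedBall, dist_zero_right] at hβ
    have hZ := PlaqSystem.partZ_ne_zero hR hβ V
    rw [← hexp β]
    unfold PlaqSystem.expect
    field_simp
  exact ((hbig.mul (isBigO_inv_partZ_sq hR V)).congr_right fun β => mul_one _).congr' hev.symm
    EventuallyEq.rfl

end Truncated

end Summit.QuantumFields.YangMills.Theorems.StrongCouplingShape

end
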